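import Summits.MatrixMultiplication.MatrixMultiplication.Theorems.LevelGradedCohnUmansLevelOneGL2DesignsMultiquadraticNoWrap
import Literature.Combinatorics.Extremal.PointLineInducedMatchingsProofs

/-!
# The multiquadratic trace-zero lift: tangency sets of `AG(2,q)` from `ℤ[√ℓ_S : S ∈ 𝒮]` (wall-breaker axis
`parabola lifts over finite fields`, stub `stub_tangencySets` of the crux `LevelOneGL2Designs`,
stmt-MatrixMultiplication-14080 — all-primes trace-zero lift, file 4)

Pohoata 2026 (arXiv:2607.20422), Prop. 5.1, for the multiquadratic orders in explicit coordinates.  Fix primes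
`ℓ : ι → ℕ` (injective), a prime `q`, a field `F ⊇ 𝔽_q` with square roots `t_i² = ℓ_i`, and signs
`σ_i ∈ {±1} ⊂ 𝔽_q` with `t_i^q = σ_i t_i` (Euler: `σ_i = ℓ_i^{(q−1)/2}`, `root_pow_prime`).  Put
`𝒮 = {S : ∏_{i∈S} σ_i = 1}` — a subgroup of `(2^ι, ∆)` of index `≤ 2` (`empty_mem_signSet`,
`symmDiff_mem_signSet`, `two_mul_card_signSet`), the multiquadratic analogue of "`q` splits completely in the fixed
field of its Frobenius": for `S ∈ 𝒮` the root `∏_{i∈S} t_i` is Frobenius-fixed, hence lies in the prime field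
(`prod_root_mem_range`), so the reduction `G(c) = Σ_S c_S θ_S ∈ 𝔽_q` (`θ_S ↦ ∏_{i∈S} t_i`) is defined on the
sub-order `R_𝒮` and is a ring homomorphism there (`eval_eq_algebraMap` + `eval_star`).

* `key` — for coordinate vectors `x, x'` (box `B`) and TRACE-ZERO `a, a'` (box `B²`, `a_∅ = a'_∅ = 0`) supported on
  `𝒮`: `(G x' − G x)² = G a − G a'` forces `(x, a) = (x', a')` once `d!·(H·∏ℓ_i)^d < q`
  (`H = 2^{|ι|}(2B)²∏ℓ_i + 2B²` bounds the coordinates of `z = (x'−x)⋆(x'−x) − (a−a')`): no wrap-around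
  (`eq_zero_of_eval_eq_zero`) gives `z = 0`, the trace coordinate `z_∅ = Σ_S (x'−x)_S² ℓ_S` gives `x = x'`.
* `exists_pointSet` — the points `v_{a,x} = (G(x)² + G(a), G(x)) ∈ 𝔽_q²` with the lines of normal `(1, −2G(x))`
  form a tangency set (induced point–line matching) of size exactly `(2B+1)^d (2B²+1)^{d−1}`, `d = |𝒮|`.

No definitions (boxes, signs and `𝒮` enter through hypotheses `h𝒮 : S ∈ 𝒮 ↔ ∏_{i∈S} σ_i = 1` etc.).
-/

-- the summit/problem path `MatrixMultiplication.MatrixMultiplication` is fixed by the tree layout (D-0017)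
set_option linter.dupNamespace false

noncomputable section

open Finset Matrix

namespace Summit.MatrixMultiplication.MatrixMultiplication.Theorems.LevelOneGL2Designs.Multiquadratic

variable {ι : Type*} [Fintype ι] [DecidableEq ι] (ℓ : ι → ℕ)

/-! ## The sign subgroup `𝒮 = {S : ∏_{i∈S} σ_i = 1}` -/
section signs
variable {K : Type*} [CommRing K] [NoZeroDivisors K] {σ : ι → K} {𝒮 : Finset (Finset ι)}

omit [Fintype ι] [DecidableEq ι] [NoZeroDivisors K] in
/-- `∅ ∈ 𝒮`. [elementary] -/
theorem empty_mem_signSet (h𝒮 : ∀ S, S ∈ 𝒮 ↔ ∏ i ∈ S, σ i = 1) : (∅ : Finset ι) ∈ 𝒮 :=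
  (h𝒮 ∅).2 (by simp)

omit [Fintype ι] [NoZeroDivisors K] in
/-- A product of signs `σ_i = ±1` is `±1`; more precisely `(∏_S σ)(∏_T σ) = ∏_{S∆T} σ` when all `σ_i² = 1`.
[elementary] -/
theorem prod_sign_mul (hσ : ∀ i, σ i ^ 2 = 1) (S T : Finset ι) :
    (∏ i ∈ S, σ i) * (∏ i ∈ T, σ i) = ∏ i ∈ symmDiff S T, σ i := by
  have := prod_root_mul (fun _ : ι => (1 : ℕ)) σ (fun i => by rw [hσ i]; simp) S T
  rw [this]; simp

omit [Fintype ι] [NoZeroDivisors K] in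
/-- `𝒮` is closed under symmetric difference. [elementary] -/
theorem symmDiff_mem_signSet (hσ : ∀ i, σ i ^ 2 = 1) (h𝒮 : ∀ S, S ∈ 𝒮 ↔ ∏ i ∈ S, σ i = 1) :
    ∀ S ∈ 𝒮, ∀ T ∈ 𝒮, symmDiff S T ∈ 𝒮 := by
  intro S hS T hT
  rw [h𝒮] at hS hT ⊢
  rw [← prod_sign_mul hσ, hS, hT, one_mul]

/-- **`𝒮` has index at most `2`**: `2^{|ι|} ≤ 2|𝒮|` (if some `σ_{i₀} ≠ 1`, so `σ_{i₀} = −1`, then `S ↦ S ∆ {i₀}`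
maps the complement of `𝒮` injectively into `𝒮`). [elementary] -/
theorem two_mul_card_signSet (hσ : ∀ i, σ i = 1 ∨ σ i = -1)
    (h𝒮 : ∀ S, S ∈ 𝒮 ↔ ∏ i ∈ S, σ i = 1) : 2 ^ Fintype.card ι ≤ 2 * 𝒮.card := by
  classical
  have hσ2 : ∀ i, σ i ^ 2 = 1 := fun i => by rcases hσ i with h | h <;> simp [h]
  by_cases hall : ∀ i, σ i = 1
  · have : 𝒮 = Finset.univ := by
      ext S; simp only [Finset.mem_univ, iff_true, h𝒮]
      exact Finset.prod_eq_one fun i _ => hall i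
    rw [this, Finset.card_univ, Fintype.card_finset]; omega
  push Not at hall
  obtain ⟨i₀, hi₀⟩ := hall
  have hi₀' : σ i₀ = -1 := (hσ i₀).resolve_left hi₀
  -- the complement maps into `𝒮`
  have hmap : ∀ S, S ∉ 𝒮 → symmDiff S {i₀} ∈ 𝒮 := by
    intro S hS
    rw [h𝒮] at hS ⊢
    have hpm : (∏ i ∈ S, σ i) = -1 := by
      have h2 : (∏ i ∈ S, σ i) * (∏ i ∈ S, σ i) = 1 := by
        rw [← Finset.prod_mul_distrib]; exact Finset.prod_eq_one fun i _ => by rw [← sq, hσ2 i]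
      rcases mul_self_eq_one_iff.1 h2 with h | h
      · exact absurd h hS
      · exact h
    rw [← prod_sign_mul hσ2, hpm, Finset.prod_singleton, hi₀']; ring
  have hinj : Set.InjOn (fun S : Finset ι => symmDiff S {i₀}) ↑(𝒮ᶜ) := by
    intro S _ T _ hST
    have : symmDiff (symmDiff S {i₀}) {i₀} = symmDiff (symmDiff T {i₀}) {i₀} := by
      simp only at hST; rw [hST]
    simpa [symmDiff_assoc] using this
  have hsub : (𝒮ᶜ).image (fun S : Finset ι => symmDiff S {i₀}) ⊆ 𝒮 := by
    intro U hU
    obtain ⟨S, hS, rfl⟩ := Finset.mem_image.1 hU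
    exact hmap S (Finset.mem_compl.1 hS)
  have h1 : (𝒮ᶜ).card ≤ 𝒮.card := by
    calc (𝒮ᶜ).card = ((𝒮ᶜ).image fun S : Finset ι => symmDiff S {i₀}).card :=
          (Finset.card_image_of_injOn hinj).symm
      _ ≤ 𝒮.card := Finset.card_le_card hsub
  have h2 : 𝒮.card + (𝒮ᶜ).card = 2 ^ Fintype.card ι := by
    rw [Finset.card_add_card_compl, Fintype.card_finset]
  omega

end signs

/-! ## Frobenius: the roots `∏_{i∈S} t_i`, `S ∈ 𝒮`, lie in the prime field -/
section rationality
variable (q : ℕ) [Fact q.Prime] {F : Type*} [Field F] [Algebra (ZMod q) F]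

omit [Fintype ι] [DecidableEq ι] in
/-- **Euler**: if `t² = ℓ` in `F ⊇ 𝔽_q`, `q` odd, then `t^q = ℓ^{(q−1)/2} · t`. [elementary] -/
theorem root_pow_prime (hq2 : q ≠ 2) (t : ι → F) (ht : ∀ i, t i ^ 2 = (ℓ i : F)) (i : ι) :
    t i ^ q = algebraMap (ZMod q) F (((ℓ i : ℕ) : ZMod q) ^ (q / 2)) * t i := by
  have hodd : q % 2 = 1 := (Fact.out : q.Prime).eq_two_or_odd.resolve_left hq2
  have hq : q = 2 * (q / 2) + 1 := by omega
  conv_lhs => rw [hq]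
  rw [pow_succ, pow_mul, ht i, map_pow, map_natCast]

omit [Fintype ι] [DecidableEq ι] in
/-- **Frobenius-fixed roots are rational**: if `t_i^q = σ_i t_i` and `∏_{i∈S} σ_i = 1` then `∏_{i∈S} t_i ∈ 𝔽_q`.
[folklore] -/
theorem prod_root_mem_range (σ : ι → ZMod q) (t : ι → F)
    (hfrob : ∀ i, t i ^ q = algebraMap (ZMod q) F (σ i) * t i) {S : Finset ι} (hS : ∏ i ∈ S, σ i = 1) :
    (∏ i ∈ S, t i) ∈ Set.range (algebraMap (ZMod q) F) := by
  apply Literature.Combinatorics.Extremal.Pohoata2026.mem_range_algebraMap_of_pow_eq q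
  rw [← Finset.prod_pow]
  simp_rw [hfrob]
  rw [Finset.prod_mul_distrib, ← map_prod, hS, map_one, one_mul]

end rationality

/-! ## The lift -/
section lift
variable {q : ℕ} [Fact q.Prime] {F : Type*} [Field F] [Algebra (ZMod q) F]

/-- The reduction `G(c) = Σ_S c_S θ_S ∈ 𝔽_q` lifts the evaluation: `E_t(c) = G(c)` in `F` for `c` supported on `𝒮`.
[elementary] -/
theorem eval_eq_algebraMap {𝒮 : Finset (Finset ι)} (t : ι → F) (θ : Finset ι → ZMod q)
    (hθ : ∀ S ∈ 𝒮, algebraMap (ZMod q) F (θ S) = ∏ i ∈ S, t i) {c : Finset ι → ℤ}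
    (hc : ∀ S, S ∉ 𝒮 → c S = 0) :
    (∑ S : Finset ι, (c S : F) * ∏ i ∈ S, t i) = algebraMap (ZMod q) F (∑ S : Finset ι, (c S : ZMod q) * θ S) := by
  rw [map_sum]
  refine Finset.sum_congr rfl fun S _ => ?_
  by_cases hS : S ∈ 𝒮
  · rw [map_mul, hθ S hS, map_intCast]
  · rw [hc S hS]; simp

/-- **Key lemma** (Pohoata 2026, Prop. 5.1, "every off-diagonal incidence remains absent after reduction", for the
multiquadratic orders): with `x, x'` in the box `B`, `a, a'` trace-zero in the box `B²`, all supported on `𝒮`,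
and `d!·(H ∏ℓ_i)^d < q`, the relation `(G x' − G x)² = G a − G a'` in `𝔽_q` forces `x = x'` and `a = a'`.
[Pohoata 2026 Prop. 5.1, explicit form] -/
theorem key (hprime : ∀ i, (ℓ i).Prime) (hinj : Function.Injective ℓ)
    {𝒮 : Finset (Finset ι)} (h0 : ∅ ∈ 𝒮) (hΔ : ∀ S ∈ 𝒮, ∀ T ∈ 𝒮, symmDiff S T ∈ 𝒮)
    (t : ι → F) (ht : ∀ i, t i ^ 2 = (ℓ i : F)) (θ : Finset ι → ZMod q)
    (hθ : ∀ S ∈ 𝒮, algebraMap (ZMod q) F (θ S) = ∏ i ∈ S, t i) {B : ℕ}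
    (hq : (𝒮.card.factorial : ℤ) *
      (((2 ^ Fintype.card ι * (2 * B) * (2 * B) * (∏ i, ℓ i) + 2 * B ^ 2 : ℕ) : ℤ) * ∏ i, (ℓ i : ℤ)) ^ 𝒮.card < q)
    {x x' a a' : Finset ι → ℤ}
    (hx : ∀ S, S ∉ 𝒮 → x S = 0) (hx' : ∀ S, S ∉ 𝒮 → x' S = 0)
    (ha : ∀ S, S ∉ 𝒮 → a S = 0) (ha' : ∀ S, S ∉ 𝒮 → a' S = 0)
    (hxB : ∀ S, |x S| ≤ B) (hx'B : ∀ S, |x' S| ≤ B) (haB : ∀ S, |a S| ≤ B ^ 2) (ha'B : ∀ S, |a' S| ≤ B ^ 2)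
    (ha0 : a ∅ = 0) (ha'0 : a' ∅ = 0)
    (h : ((∑ S : Finset ι, (x' S : ZMod q) * θ S) - ∑ S : Finset ι, (x S : ZMod q) * θ S) ^ 2 =
      (∑ S : Finset ι, (a S : ZMod q) * θ S) - ∑ S : Finset ι, (a' S : ZMod q) * θ S) :
    x = x' ∧ a = a' := by
  classical
  haveI : CharP F q := charP_of_injective_algebraMap (algebraMap (ZMod q) F).injective q
  have hℓ : ∀ i, 1 ≤ ℓ i := fun i => (hprime i).one_lt.le
  -- the difference vectors and `z = δ ⋆ δ − ε`
  set δ : Finset ι → ℤ := fun S => x' S - x S with hδ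
  set ε : Finset ι → ℤ := fun S => a S - a' S with hε
  set z : Finset ι → ℤ :=
    fun U => (∑ S : Finset ι, δ S * δ (symmDiff S U) * ∏ i ∈ S \ U, (ℓ i : ℤ)) - ε U with hz
  have hδs : ∀ S, S ∉ 𝒮 → δ S = 0 := fun S hS => by simp [hδ, hx S hS, hx' S hS]
  have hεs : ∀ S, S ∉ 𝒮 → ε S = 0 := fun S hS => by simp [hε, ha S hS, ha' S hS]
  have hzs : ∀ U, U ∉ 𝒮 → z U = 0 := fun U hU => by
    simp only [hz, star_support ℓ hΔ hδs hδs hU, hεs U hU, sub_zero]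
  -- `E(z) = 0` in `F`
  have hEδ : (∑ S : Finset ι, (δ S : F) * ∏ i ∈ S, t i) =
      algebraMap (ZMod q) F ((∑ S : Finset ι, (x' S : ZMod q) * θ S) - ∑ S : Finset ι, (x S : ZMod q) * θ S) := by
    rw [map_sub, ← eval_eq_algebraMap t θ hθ hx', ← eval_eq_algebraMap t θ hθ hx, ← eval_sub]
  have hEε : (∑ S : Finset ι, (ε S : F) * ∏ i ∈ S, t i) =
      algebraMap (ZMod q) F ((∑ S : Finset ι, (a S : ZMod q) * θ S) - ∑ S : Finset ι, (a' S : ZMod q) * θ S) := by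
    rw [map_sub, ← eval_eq_algebraMap t θ hθ ha, ← eval_eq_algebraMap t θ hθ ha', ← eval_sub]
  have hEz : (∑ U : Finset ι, (z U : F) * ∏ i ∈ U, t i) = 0 := by
    have hsplit : (∑ U : Finset ι, (z U : F) * ∏ i ∈ U, t i) =
        (∑ U : Finset ι, ((∑ S : Finset ι, δ S * δ (symmDiff S U) * ∏ i ∈ S \ U, (ℓ i : ℤ) : ℤ) : F) *
          ∏ i ∈ U, t i) - ∑ U : Finset ι, (ε U : F) * ∏ i ∈ U, t i := by
      rw [← eval_sub]
    rw [hsplit, ← eval_star ℓ t ht δ δ, hEδ, hEε, ← map_mul, ← map_sub, ← sq, h, sub_self, map_zero]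
  -- coordinates of `z` are small
  set L : ℕ := ∏ i, ℓ i with hL
  have hδB : ∀ S, |δ S| ≤ 2 * (B : ℤ) := fun S => by
    calc |δ S| = |x' S - x S| := rfl
      _ ≤ |x' S| + |x S| := abs_sub _ _
      _ ≤ B + B := add_le_add (hx'B S) (hxB S)
      _ = 2 * (B : ℤ) := by ring
  have hzB : ∀ U, |z U| ≤ ((2 ^ Fintype.card ι * (2 * B) * (2 * B) * L + 2 * B ^ 2 : ℕ) : ℤ) := by
    intro U
    have h1 := abs_star_le ℓ hδB hδB (fun S => prod_le_prod_univ ℓ hℓ S) U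
    have h2 : |ε U| ≤ 2 * (B : ℤ) ^ 2 := by
      calc |ε U| = |a U - a' U| := rfl
        _ ≤ |a U| + |a' U| := abs_sub _ _
        _ ≤ (B : ℤ) ^ 2 + (B : ℤ) ^ 2 := add_le_add (haB U) (ha'B U)
        _ = 2 * (B : ℤ) ^ 2 := by ring
    calc |z U| ≤ |∑ S : Finset ι, δ S * δ (symmDiff S U) * ∏ i ∈ S \ U, (ℓ i : ℤ)| + |ε U| := abs_sub _ _
      _ ≤ 2 ^ Fintype.card ι * (2 * (B : ℤ)) * (2 * B) * L + 2 * (B : ℤ) ^ 2 := add_le_add h1 h2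
      _ = ((2 ^ Fintype.card ι * (2 * B) * (2 * B) * L + 2 * B ^ 2 : ℕ) : ℤ) := by push_cast; ring
  -- no wrap-around: `z = 0`
  have hz0 : z = 0 := eq_zero_of_eval_eq_zero ℓ hprime hinj h0 hΔ hzs hzB hq t ht hEz
  -- the trace coordinate: `(δ ⋆ δ)_∅ = ε_∅ = 0`, so `δ = 0`
  have hε0 : ε ∅ = 0 := by simp [hε, ha0, ha'0]
  have hδ0 : δ = 0 := by
    refine eq_zero_of_star_self_empty ℓ hℓ ?_
    have := congrFun hz0 ∅
    simp only [hz, Pi.zero_apply, hε0, sub_zero] at this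
    exact this
  have hxx : x = x' := by
    funext S
    have := congrFun hδ0 S
    simp only [hδ, Pi.zero_apply] at this
    linarith
  refine ⟨hxx, ?_⟩
  funext S
  have h1 := congrFun hz0 S
  simp only [hz, Pi.zero_apply, hδ0, zero_mul, Finset.sum_const_zero, zero_sub, neg_eq_zero] at h1
  simp only [hε] at h1
  linarith

/-- **The point set** (Pohoata 2026, Prop. 5.1 for `R_𝒮`): under the hypotheses of `key`, the `𝔽_q`-points
`(G(x)² + G(a), G(x))`, `x` in the box `B` and `a` trace-zero in the box `B²` (both supported on `𝒮`), are
pairwise distinct, number `(2B+1)^d (2B²+1)^{d−1}` (`d = |𝒮|`), and each lies on a line (normal `(1, −2G(x))`)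
meeting the set only in that point. [Pohoata 2026 Prop. 5.1, explicit form] -/
theorem exists_pointSet (hprime : ∀ i, (ℓ i).Prime) (hinj : Function.Injective ℓ)
    {𝒮 : Finset (Finset ι)} (h0 : ∅ ∈ 𝒮) (hΔ : ∀ S ∈ 𝒮, ∀ T ∈ 𝒮, symmDiff S T ∈ 𝒮)
    (t : ι → F) (ht : ∀ i, t i ^ 2 = (ℓ i : F)) (θ : Finset ι → ZMod q)
    (hθ : ∀ S ∈ 𝒮, algebraMap (ZMod q) F (θ S) = ∏ i ∈ S, t i) (B : ℕ)
    (hq : (𝒮.card.factorial : ℤ) *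
      (((2 ^ Fintype.card ι * (2 * B) * (2 * B) * (∏ i, ℓ i) + 2 * B ^ 2 : ℕ) : ℤ) * ∏ i, (ℓ i : ℤ)) ^ 𝒮.card < q) :
    ∃ V : Finset (Fin 2 → ZMod q), V.card = (2 * B + 1) ^ 𝒮.card * (2 * B ^ 2 + 1) ^ (𝒮.card - 1) ∧
      ∀ v ∈ V, ∃ u : Fin 2 → ZMod q, u ≠ 0 ∧ ∀ w ∈ V, u ⬝ᵥ w = u ⬝ᵥ v → w = v := by
  classical
  -- the boxes
  set boxX : Finset (Finset ι → ℤ) :=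
    Fintype.piFinset fun S : Finset ι => if S ∈ 𝒮 then Finset.Icc (-(B : ℤ)) B else {0} with hboxX
  set boxA : Finset (Finset ι → ℤ) :=
    Fintype.piFinset fun S : Finset ι => if S ∈ 𝒮 ∧ S ≠ ∅ then Finset.Icc (-(B : ℤ) ^ 2) ((B : ℤ) ^ 2) else {0}
    with hboxA
  have memX : ∀ x ∈ boxX, (∀ S, S ∉ 𝒮 → x S = 0) ∧ ∀ S, |x S| ≤ B := by
    intro x hx
    rw [hboxX, Fintype.mem_piFinset] at hx
    refine ⟨fun S hS => ?_, fun S => ?_⟩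
    · have := hx S; rw [if_neg hS, Finset.mem_singleton] at this; exact this
    · have := hx S
      by_cases hS : S ∈ 𝒮
      · rw [if_pos hS, Finset.mem_Icc] at this; exact abs_le.2 this
      · rw [if_neg hS, Finset.mem_singleton] at this; rw [this]; simp
  have memA : ∀ a ∈ boxA, (∀ S, S ∉ 𝒮 → a S = 0) ∧ (∀ S, |a S| ≤ (B : ℤ) ^ 2) ∧ a ∅ = 0 := by
    intro a ha
    rw [hboxA, Fintype.mem_piFinset] at ha
    refine ⟨fun S hS => ?_, fun S => ?_, ?_⟩
    · have := ha S; rw [if_neg (fun h => hS h.1), Finset.mem_singleton] at this; exact this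
    · have := ha S
      by_cases hS : S ∈ 𝒮 ∧ S ≠ ∅
      · rw [if_pos hS, Finset.mem_Icc] at this
        exact abs_le.2 ⟨by linarith [this.1], this.2⟩
      · rw [if_neg hS, Finset.mem_singleton] at this; rw [this]; positivity
    · have := ha ∅; rw [if_neg (fun h => h.2 rfl), Finset.mem_singleton] at this; exact this
  -- the reduction and the points
  let G : (Finset ι → ℤ) → ZMod q := fun c => ∑ S : Finset ι, (c S : ZMod q) * θ S
  let P : (Finset ι → ℤ) × (Finset ι → ℤ) → (Fin 2 → ZMod q) := fun ax => ![G ax.2 ^ 2 + G ax.1, G ax.2]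
  have key' : ∀ ax ∈ boxA ×ˢ boxX, ∀ ax' ∈ boxA ×ˢ boxX,
      (G ax'.2 - G ax.2) ^ 2 = G ax.1 - G ax'.1 → ax = ax' := by
    intro ax hax ax' hax' hrel
    obtain ⟨hax1, hax2⟩ := Finset.mem_product.1 hax
    obtain ⟨hax1', hax2'⟩ := Finset.mem_product.1 hax'
    obtain ⟨hxs, hxB⟩ := memX _ hax2
    obtain ⟨hxs', hxB'⟩ := memX _ hax2'
    obtain ⟨has, haB, ha0⟩ := memA _ hax1
    obtain ⟨has', haB', ha0'⟩ := memA _ hax1'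
    have := key ℓ hprime hinj h0 hΔ t ht θ hθ hq hxs hxs' has has' hxB hxB' haB haB' ha0 ha0' hrel
    exact Prod.ext this.2 this.1
  refine ⟨(boxA ×ˢ boxX).image P, ?_, ?_⟩
  · -- counting
    have hinjP : Set.InjOn P ↑(boxA ×ˢ boxX) := by
      intro ax hax ax' hax' hP
      have h2 : G ax.2 = G ax'.2 := by
        have := congrFun hP 1; simpa [P] using this
      have h1 : G ax.2 ^ 2 + G ax.1 = G ax'.2 ^ 2 + G ax'.1 := by
        have := congrFun hP 0; simpa [P] using this
      refine key' ax hax ax' hax' ?_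
      rw [h2] at h1 ⊢
      linear_combination -h1
    have hcardX : boxX.card = (2 * B + 1) ^ 𝒮.card := by
      rw [hboxX, Fintype.card_piFinset]
      simp only [apply_ite Finset.card, Finset.card_singleton]
      rw [Finset.prod_ite, Finset.prod_const_one, mul_one, Finset.prod_const, Finset.filter_mem_eq_inter,
        Finset.univ_inter, Int.card_Icc]
      congr 1; omega
    have hcardA : boxA.card = (2 * B ^ 2 + 1) ^ (𝒮.card - 1) := by
      rw [hboxA, Fintype.card_piFinset]
      simp only [apply_ite Finset.card, Finset.card_singleton]
      rw [Finset.prod_ite, Finset.prod_const_one, mul_one, Finset.prod_const, Int.card_Icc]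
      have hfil : (Finset.univ.filter fun S : Finset ι => S ∈ 𝒮 ∧ S ≠ ∅) = 𝒮.erase ∅ := by
        ext S; simp only [Finset.mem_filter, Finset.mem_univ, true_and, Finset.mem_erase]; tauto
      rw [hfil, Finset.card_erase_of_mem h0]
      congr 1
      have : ((B : ℤ) ^ 2 + 1 - -(B : ℤ) ^ 2) = ((2 * B ^ 2 + 1 : ℕ) : ℤ) := by push_cast; ring
      rw [this, Int.toNat_natCast]
    rw [Finset.card_image_of_injOn hinjP, Finset.card_product, hcardA, hcardX, mul_comm]
  · -- the matching
    intro v hv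
    obtain ⟨ax, hax, rfl⟩ := Finset.mem_image.mp hv
    refine ⟨![1, -2 * G ax.2], ?_, ?_⟩
    · intro h0'
      have := congrFun h0' 0
      simp at this
    · intro w hw hdot
      obtain ⟨ax', hax', rfl⟩ := Finset.mem_image.mp hw
      have heq : (G ax'.2 - G ax.2) ^ 2 = G ax.1 - G ax'.1 := by
        simp only [P, dotProduct, Fin.sum_univ_two, Matrix.cons_val_zero, Matrix.cons_val_one] at hdot
        linear_combination hdot
      rw [key' ax hax ax' hax' heq]

end lift

end Summit.MatrixMultiplication.MatrixMultiplication.Theorems.LevelOneGL2Designs.Multiquadratic
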